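import Literature.MathematicalPhysics.QuantumFieldTheory.ConstructiveQFTWave0WilsonLoopRPProofs
import Literature.MathematicalPhysics.QuantumFieldTheory.ConstructiveQFTWave0OddRPProofs
import HarnessLib

/-!
# Reflection-positivity (Gram) inequalities for rectangular Wilson loops on the ODD torus

Theorem-only companion of `ConstructiveQFTWave0WilsonLoopRPProofs` (even torus) using the
reflection positivity of the odd torus `ConstructiveQFTWave0OddRPProofs` (`L = 2m + 1`, reflection
`θ t = 1 - t` fixing the hyperplane `t = 1/2` between sites and the hyperplane `t = m + 1` through
sites). For the rectangular Wilson loops `W_L(h) = ⟨W_{h × R}⟩_{Λ_L,β}` (`h` steps in the time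
direction `0`, `R` steps in a spatial direction `j`, `wilsonLoop ρ 0 0 j h R`) we prove the two
Gram inequalities of the transfer-matrix formalism (Seiler LNP 159 §2) on odd tori, `β ≥ 0`:

* `gram_wilsonLoop_nonneg_odd_of_odd`: `0 ≤ ∑_{a,b ∈ S} c_a c_b W_L(a + b + 1)` (heights
  `a + 1 ≤ L/2`): loops bisected by the hyperplane between sites — the link staples and the
  covariance identity of the even file, with the lower-only substitution `translateLow`;
* `gram_wilsonLoop_nonneg_even_of_odd`: `0 ≤ ∑_{a,b ∈ S} c_a c_b W_L(a + b)` (heights `a ≤ L/2`):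
  loops bisected by the site hyperplane `t = m + 1` — staples HANGING from that hyperplane
  (`hangStaple`), whose reflections are the standing staples above it
  (`hangStaple_timeReflect`, `rectangleHolonomy_eq_hang`).

All statements here are proved; the only definitions are the hanging staple, its base point
and its edge predicate. [folklore]
-/

open MeasureTheory Finset Complex
open scoped ComplexOrder ENNReal ComplexConjugate

namespace Literature.MathematicalPhysics.QuantumFieldTheory

noncomputable section

namespace WilsonLoopOddRP

open WilsonRP WilsonOddRP WilsonLoopRP
open Literature.RepresentationTheory.CompactGroups

/-- Rearranging a Gram double sum of matrix entries. [folklore] -/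
private theorem sum_sum_mul_sum_sum {α : Type*} [Fintype α] (S : Finset ℕ) (f g : ℕ → α → α → ℂ) :
    ∑ i : α, ∑ l : α, (∑ a ∈ S, f a i l) * (∑ b ∈ S, g b i l) =
      ∑ a ∈ S, ∑ b ∈ S, ∑ i : α, ∑ l : α, f a i l * g b i l := by
  simp only [Finset.sum_mul_sum]
  calc ∑ i : α, ∑ l : α, ∑ a ∈ S, ∑ b ∈ S, f a i l * g b i l
      = ∑ i : α, ∑ a ∈ S, ∑ l : α, ∑ b ∈ S, f a i l * g b i l :=
        Finset.sum_congr rfl fun i _ => Finset.sum_comm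
    _ = ∑ a ∈ S, ∑ i : α, ∑ l : α, ∑ b ∈ S, f a i l * g b i l := Finset.sum_comm
    _ = ∑ a ∈ S, ∑ i : α, ∑ b ∈ S, ∑ l : α, f a i l * g b i l :=
        Finset.sum_congr rfl fun a _ => Finset.sum_congr rfl fun i _ => Finset.sum_comm
    _ = ∑ a ∈ S, ∑ b ∈ S, ∑ i : α, ∑ l : α, f a i l * g b i l :=
        Finset.sum_congr rfl fun a _ => Finset.sum_comm

/-! ## Link-bisected rectangles on the odd torus -/

section Link

variable {d L N : ℕ} [NeZero d] [NeZero L] [Fact (1 < L)]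
variable {G : Type*} [Group G] [TopologicalSpace G] [IsTopologicalGroup G] [CompactSpace G]
  [MeasurableSpace G] [BorelSpace G]
variable (ρ : G →* Matrix (Fin N) (Fin N) ℂ)

omit [NeZero L] in
/-- A positive link of the even bookkeeping is a positive, non-crossing link of the odd
bookkeeping (`1 ≤ t ≤ L/2`). [folklore] -/
theorem isOPosEdge_of_isPosEdge {e : Edge d L} (he : IsPosEdge e) : IsOPosEdge e ∧ ¬ IsLowerCross e := by
  rw [isPosEdge_iff] at he
  obtain ⟨h1, h2⟩ := he
  refine ⟨⟨h1, ?_⟩, fun hc => ?_⟩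
  · split_ifs at h2 <;> omega
  · have := hc.2; omega

omit [NeZero L] in
/-- The reflection of a link of a link staple is not a crossing link. [folklore] -/
theorem not_isLowerCross_edgeReflect_of_isPosEdge {e : Edge d L} (he : IsPosEdge e) :
    ¬ IsLowerCross (edgeReflect e) := by
  intro hc
  have h := edgeReflect_of_isLowerCross (d := d) (L := L) hc
  rw [edgeReflect_edgeReflect] at h
  rw [h] at he
  exact (isOPosEdge_of_isPosEdge he).2 hc

omit [MeasurableSpace G] [BorelSpace G] in
/-- **The covariance identity on the odd torus** (lower-only substitution). [folklore] -/
theorem trace_rectangleHolonomy_translateLow (hρ : Continuous ρ) {j : Fin d} (hj : j ≠ 0)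
    {R a b : ℕ} (ha : a + 1 ≤ L / 2) (hb : b + 1 ≤ L / 2) (U Y : GaugeConfig d L G) :
    (CompactGroup.unitarize ρ hρ
        (rectangleHolonomy (translateLow Y U) (tBase b) 0 j (a + b + 1) R)).trace =
      ∑ i, ∑ l, CompactGroup.unitarize ρ hρ (linkWord j R a (LatticeRP.splice lowerEdges (U, Y))) i l *
        conj (CompactGroup.unitarize ρ hρ (linkWord j R b U.timeReflect) i l) := by
  obtain ⟨hc0, hcR⟩ := isLowerCross_foot (L := L) j hj R
  obtain ⟨hΘ0, hΘR⟩ := timeReflect_apply_foot U hj R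
  have hSa : linkStaple j R a (translateLow Y U) = linkStaple j R a U :=
    linkStaple_congr j R a fun _ he => translateLow_apply_of_not_isLowerCross Y U
      (isOPosEdge_of_isPosEdge (isPosEdge_of_isLinkStapleEdge hj ha he)).2
  have hSz : linkStaple j R a (LatticeRP.splice lowerEdges (U, Y)) = linkStaple j R a U :=
    linkStaple_congr j R a fun _ he => splice_apply_of_not_isLowerCross U Y
      (isOPosEdge_of_isPosEdge (isPosEdge_of_isLinkStapleEdge hj ha he)).2
  have hSb : linkStaple j R b (translateLow Y U).timeReflect = linkStaple j R b U.timeReflect :=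
    linkStaple_congr j R b fun _ he => by
      rw [timeReflect_apply, timeReflect_apply, translateLow_apply_of_not_isLowerCross Y U
        (not_isLowerCross_edgeReflect_of_isPosEdge (isPosEdge_of_isLinkStapleEdge hj hb he))]
  rw [rectangleHolonomy_eq_link _ hj, CompactGroup.trace_conj_eq, ← trace_unitarize_mul_inv ρ hρ]
  unfold linkWord
  rw [translateLow_apply_of_isLowerCross Y U hc0, translateLow_apply_of_isLowerCross Y U hcR, hSa, hSb,
    splice_apply_of_isLowerCross U Y hc0, splice_apply_of_isLowerCross U Y hcR, hSz, hΘ0, hΘR]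
  rw [show U (0, 0) * Y (0, 0) * linkStaple j R a U *
        (U ((0 : Site d L) + Pi.single j (R : ZMod L), 0) *
          Y ((0 : Site d L) + Pi.single j (R : ZMod L), 0))⁻¹ *
        (linkStaple j R b U.timeReflect)⁻¹ =
      U (0, 0) * (Y (0, 0) * linkStaple j R a U * (Y ((0 : Site d L) + Pi.single j (R : ZMod L), 0))⁻¹ *
        ((U (0, 0))⁻¹ * linkStaple j R b U.timeReflect *
          ((U ((0 : Site d L) + Pi.single j (R : ZMod L), 0))⁻¹)⁻¹)⁻¹) * (U (0, 0))⁻¹ by group,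
    CompactGroup.trace_conj_eq]

/-- **Gram positivity for link-bisected rectangles on the odd torus** (complex form). [folklore] -/
theorem wilsonExpectation_gram_link_nonneg (hL : Odd L) (hL3 : 3 ≤ L) (hρ : Continuous ρ) {β : ℝ}
    (hβ : 0 ≤ β) {j : Fin d} (hj : j ≠ 0) (R : ℕ) (S : Finset ℕ) (hS : ∀ a ∈ S, a + 1 ≤ L / 2)
    (c : ℕ → ℝ) :
    0 ≤ wilsonExpectation ρ β fun U : GaugeConfig d L G => ∑ a ∈ S, ∑ b ∈ S, (c a * c b : ℂ) *
      (CompactGroup.unitarize ρ hρ (rectangleHolonomy U (tBase b) 0 j (a + b + 1) R)).trace := by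
  set σ := CompactGroup.unitarize ρ hρ with hσdef
  refine wilsonExpectation_nonneg_of_oddCovariant ρ hL hL3 hρ hβ (K := Fin N × Fin N)
    (g := fun il V => ∑ a ∈ S, (c a : ℂ) * σ (linkWord j R a V) il.1 il.2)
    (fun il => Finset.measurable_sum _ fun a _ =>
      (entryMeasurable_linkWord ρ hρ j R a il.1 il.2).const_mul _)
    (Kg := ∑ a ∈ S, ‖(c a : ℂ)‖) (fun il V => ?_) (fun il => ?_) ?_ ?_
  · refine (norm_sum_le _ _).trans (Finset.sum_le_sum fun a _ => ?_)
    rw [norm_mul]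
    exact mul_le_of_le_one_right (norm_nonneg _)
      (CompactGroup.norm_unitarize_apply_le_one ρ hρ _ _ _)
  · intro U V hUV
    refine Finset.sum_congr rfl fun a ha => ?_
    have hP : ∀ e, IsOPosEdge e → U e = V e := fun e he => hUV e (by simp [he])
    have hC : ∀ e, IsLowerCross e → U e = V e := fun e he => hUV e (by simp [he])
    obtain ⟨hc0, hcR⟩ := isLowerCross_foot (L := L) j hj R
    simp only [linkWord, hC _ hc0, hC _ hcR, linkStaple_congr j R a fun e he =>
      hP e (isOPosEdge_of_isPosEdge (isPosEdge_of_isLinkStapleEdge hj (hS a ha) he)).1]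
  · refine Finset.measurable_sum _ fun a _ => Finset.measurable_sum _ fun b _ => ?_
    exact (entryMeasurable_rectangleHolonomy ρ hρ _ _ _ _ _).measurable_trace.const_mul _
  · intro U Y
    have hL' : (∑ a ∈ S, ∑ b ∈ S, (c a * c b : ℂ) *
        (σ (rectangleHolonomy (translateLow Y U) (tBase b) 0 j (a + b + 1) R)).trace) =
        ∑ a ∈ S, ∑ b ∈ S, ∑ i, ∑ l, (c a * c b : ℂ) *
          (σ (linkWord j R a (LatticeRP.splice lowerEdges (U, Y))) i l *
            conj (σ (linkWord j R b U.timeReflect) i l)) := by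
      refine Finset.sum_congr rfl fun a ha => Finset.sum_congr rfl fun b hb => ?_
      rw [trace_rectangleHolonomy_translateLow ρ hρ hj (hS a ha) (hS b hb) U Y, Finset.mul_sum]
      refine Finset.sum_congr rfl fun i _ => ?_
      rw [Finset.mul_sum]
    rw [hL', Fintype.sum_prod_type]
    simp only [map_sum, map_mul, Complex.conj_ofReal]
    rw [sum_sum_mul_sum_sum]
    refine Finset.sum_congr rfl fun a _ => Finset.sum_congr rfl fun b _ =>
      Finset.sum_congr rfl fun i _ => Finset.sum_congr rfl fun l _ => by ring

end Link

/-! ## Rectangles bisected by the site hyperplane `t = L/2 + 1`: hanging staples -/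

section Hang

variable {d L : ℕ} [NeZero d] {G : Type*} [Group G]

/-- The base point `(L/2 + 1 - a, 0⃗)` of the hanging staple of height `a`. [folklore] -/
def hangBase (a : ℕ) : Site d L :=
  (0 : Site d L) + Pi.single 0 ((((L / 2 + 1 : ℕ) : ZMod L)) - (a : ZMod L))

/-- The point `(L/2 + 1, 0⃗)` of the site hyperplane. [folklore] -/
def pTop : Site d L := (0 : Site d L) + Pi.single 0 (((L / 2 + 1 : ℕ) : ZMod L))

/-- The staple of height `a` and width `R` (direction `j`) HANGING from the site hyperplane
`t = L/2 + 1`: the holonomy along `(L/2+1, 0⃗) → (L/2+1-a, 0⃗) → (L/2+1-a, R eⱼ) → (L/2+1, R eⱼ)`.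
[folklore] -/
def hangStaple (j : Fin d) (R a : ℕ) (V : GaugeConfig d L G) : G :=
  (lineHolonomy V 0 a (hangBase a))⁻¹ * lineHolonomy V j R (hangBase a) *
    lineHolonomy V 0 a (hangBase a + Pi.single j (R : ZMod L))

/-- `(τ - a) + a e₀ = τ`. [folklore] -/
theorem hangBase_add_single (a : ℕ) :
    (hangBase a : Site d L) + Pi.single 0 (a : ZMod L) = pTop := by
  simp only [hangBase, pTop, add_assoc, ← Pi.single_add, sub_add_cancel]

/-- `(τ - a) + (a + b) e₀ = τ + b e₀`. [folklore] -/
theorem hangBase_add_single_add (a b : ℕ) :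
    (hangBase a : Site d L) + Pi.single 0 (((a + b : ℕ) : ZMod L)) =
      pTop + Pi.single 0 (b : ZMod L) := by
  rw [← hangBase_add_single a, add_assoc, ← Pi.single_add, Nat.cast_add]

/-- `(τ - a, R eⱼ) + a e₀ = (τ, R eⱼ)`. [folklore] -/
theorem hangBase_add_single_right (j : Fin d) (R a : ℕ) :
    (hangBase a : Site d L) + Pi.single j (R : ZMod L) + Pi.single 0 (a : ZMod L) =
      pTop + Pi.single j (R : ZMod L) := by
  rw [add_right_comm, hangBase_add_single]

variable [NeZero L] [Fact (1 < L)]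

omit [NeZero L] in
/-- The time coordinate of the hyperplane point. [folklore] -/
theorem pTop_apply_zero_val (hL : Odd L) : ((pTop : Site d L) 0).val = L / 2 + 1 := by
  obtain ⟨m, hm⟩ := hL
  have h1L : 1 < L := Fact.out
  simp only [pTop, Pi.add_apply, Pi.zero_apply, Pi.single_eq_same, zero_add]
  exact ZMod.val_cast_of_lt (by omega)

/-- The hyperplane point is fixed by the reflection. [folklore] -/
theorem timeReflect_pTop (hL : Odd L) : (pTop : Site d L).timeReflect = pTop :=
  timeReflect_of_val_eq hL (pTop_apply_zero_val hL)

/-- `θ(τ, R eⱼ) = (τ, R eⱼ)` for a spatial direction `j`. [folklore] -/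
theorem timeReflect_pTop_add {j : Fin d} (hj : j ≠ 0) (hL : Odd L) (R : ℕ) :
    ((pTop : Site d L) + Pi.single j (R : ZMod L)).timeReflect = pTop + Pi.single j (R : ZMod L) := by
  refine timeReflect_of_val_eq hL ?_
  rw [Pi.add_apply, Pi.single_eq_of_ne (Ne.symm hj), add_zero]
  exact pTop_apply_zero_val hL

/-- `θ(τ - b, 0⃗) = (τ + b, 0⃗)`: `1 - (τ - b) = (1 - τ) + b ≡ τ + b`. [folklore] -/
theorem timeReflect_hangBase (hL : Odd L) (b : ℕ) :
    (hangBase b : Site d L).timeReflect = pTop + Pi.single 0 (b : ZMod L) := by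
  have h := timeReflect_pTop (d := d) hL
  funext k
  by_cases hk : k = 0
  · subst hk
    have h0 := congrFun h 0
    rw [timeReflect_apply_zero] at h0
    rw [timeReflect_apply_zero]
    simp only [hangBase, pTop, Pi.add_apply, Pi.zero_apply, Pi.single_eq_same, zero_add] at h0 ⊢
    linear_combination h0
  · rw [timeReflect_apply_of_ne _ hk]
    simp [hangBase, pTop, hk]

/-- The hanging staple of the reflected configuration is the STANDING staple above the
hyperplane: `(τ,0⃗) → (τ+b,0⃗) → (τ+b, R eⱼ) → (τ, R eⱼ)`. [folklore] -/
theorem hangStaple_timeReflect (hL : Odd L) (U : GaugeConfig d L G) {j : Fin d} (hj : j ≠ 0)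
    (R b : ℕ) :
    hangStaple j R b U.timeReflect =
      lineHolonomy U 0 b pTop * lineHolonomy U j R (pTop + Pi.single 0 (b : ZMod L)) *
        (lineHolonomy U 0 b (pTop + Pi.single j (R : ZMod L)))⁻¹ := by
  unfold hangStaple
  rw [lineHolonomy_timeReflect_zero, lineHolonomy_timeReflect_of_ne U hj,
    lineHolonomy_timeReflect_zero, hangBase_add_single, hangBase_add_single_right,
    timeReflect_pTop hL, timeReflect_pTop_add hj hL, timeReflect_hangBase hL, inv_inv]

omit [NeZero L] [Fact (1 < L)] in
/-- **Decomposition of a rectangle bisected by the site hyperplane of the odd torus.** The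
`(a+b) × R` rectangle based at `(τ - a, 0⃗)` is, up to conjugation by its lower left column,
`(standing staple_b) · (hanging staple_a)⁻¹`; with `hangStaple_timeReflect` the standing staple is
the hanging staple of `Θ U`. [folklore] -/
theorem rectangleHolonomy_eq_hang (U : GaugeConfig d L G) (j : Fin d) (R a b : ℕ) :
    rectangleHolonomy U (hangBase a) 0 j (a + b) R =
      lineHolonomy U 0 a (hangBase a) *
        ((lineHolonomy U 0 b pTop * lineHolonomy U j R (pTop + Pi.single 0 (b : ZMod L)) *
            (lineHolonomy U 0 b (pTop + Pi.single j (R : ZMod L)))⁻¹) *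
          (hangStaple j R a U)⁻¹) * (lineHolonomy U 0 a (hangBase a))⁻¹ := by
  have h1 : lineHolonomy U 0 (a + b) (hangBase a) =
      lineHolonomy U 0 a (hangBase a) * lineHolonomy U 0 b pTop := by
    rw [lineHolonomy_add, hangBase_add_single]
  have h3 : lineHolonomy U 0 (a + b) (hangBase a + Pi.single j (R : ZMod L)) =
      lineHolonomy U 0 a (hangBase a + Pi.single j (R : ZMod L)) *
        lineHolonomy U 0 b (pTop + Pi.single j (R : ZMod L)) := by
    rw [lineHolonomy_add, hangBase_add_single_right]
  unfold rectangleHolonomy hangStaple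
  rw [h1, hangBase_add_single_add, h3]
  simp only [mul_inv_rev, inv_inv, mul_assoc, mul_inv_cancel, mul_one]

/-- The links read by `hangStaple j R a` (as a predicate). [folklore] -/
def IsHangStapleEdge (j : Fin d) (R a : ℕ) (e : Edge d L) : Prop :=
  (∃ s : ℕ, s < a ∧ e = ((hangBase a : Site d L) + Pi.single 0 (s : ZMod L), 0)) ∨
    (∃ s : ℕ, s < R ∧ e = ((hangBase a : Site d L) + Pi.single j (s : ZMod L), j)) ∨
    (∃ s : ℕ, s < a ∧
      e = ((hangBase a : Site d L) + Pi.single j (R : ZMod L) + Pi.single 0 (s : ZMod L), 0))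

omit [NeZero L] [Fact (1 < L)] in
/-- The hanging staple only reads its links. [folklore] -/
theorem hangStaple_congr {U V : GaugeConfig d L G} (j : Fin d) (R a : ℕ)
    (h : ∀ e, IsHangStapleEdge j R a e → U e = V e) : hangStaple j R a U = hangStaple j R a V := by
  unfold hangStaple
  rw [lineHolonomy_congr (U := U) (V := V) 0 a _ fun s hs => h _ (Or.inl ⟨s, hs, rfl⟩),
    lineHolonomy_congr (U := U) (V := V) j R _ fun s hs => h _ (Or.inr (Or.inl ⟨s, hs, rfl⟩)),
    lineHolonomy_congr (U := U) (V := V) 0 a _ fun s hs => h _ (Or.inr (Or.inr ⟨s, hs, rfl⟩))]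

omit [NeZero L] in
/-- The time coordinate `τ - a + s` of the sites of the hanging staple. [folklore] -/
theorem val_hangBase_add (hL : Odd L) {a s : ℕ} (ha : a ≤ L / 2) (hs : s ≤ a) (w : Site d L)
    (hw : w 0 = 0) :
    (((hangBase a : Site d L) + w + Pi.single 0 (s : ZMod L) : Site d L) 0).val = L / 2 + 1 - a + s := by
  obtain ⟨m, hm⟩ := hL
  have h1L : 1 < L := Fact.out
  have hcast : (((L / 2 + 1 : ℕ) : ZMod L)) - (a : ZMod L) + (s : ZMod L) =
      ((L / 2 + 1 - a + s : ℕ) : ZMod L) := by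
    rw [Nat.cast_add (L / 2 + 1 - a) s, Nat.cast_sub (show a ≤ L / 2 + 1 by omega)]
  simp only [hangBase, Pi.add_apply, Pi.single_eq_same, zero_add, hw, add_zero]
  rw [hcast, ZMod.val_cast_of_lt (by omega)]

omit [NeZero L] in
/-- The links of a hanging staple of height `a ≤ L/2` are positive or shared for the odd
bookkeeping. [folklore] -/
theorem isOPosEdge_or_isOSharedEdge_of_isHangStapleEdge (hL : Odd L) {j : Fin d} (hj : j ≠ 0)
    {R a : ℕ} (ha : a ≤ L / 2) {e : Edge d L} (he : IsHangStapleEdge j R a e) :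
    IsOPosEdge e ∨ IsOSharedEdge e := by
  obtain ⟨m, hm⟩ := id hL
  unfold IsOPosEdge IsOSharedEdge
  rcases he with ⟨s, hs, rfl⟩ | ⟨s, hs, rfl⟩ | ⟨s, hs, rfl⟩
  · have ht := val_hangBase_add hL ha hs.le (0 : Site d L) rfl
    rw [add_zero] at ht
    left
    simp only [ht]
    omega
  · have ht : (((hangBase a : Site d L) + Pi.single j (s : ZMod L) : Site d L) 0).val = L / 2 + 1 - a := by
      have := val_hangBase_add hL ha (Nat.zero_le a) (Pi.single j (s : ZMod L))
        (Pi.single_eq_of_ne (Ne.symm hj) _)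
      simpa using this
    by_cases ha0 : a = 0
    · right
      exact ⟨hj, by simp only [ht]; omega⟩
    · left
      simp only [ht]
      omega
  · have ht := val_hangBase_add hL ha hs.le (Pi.single j (R : ZMod L)) (Pi.single_eq_of_ne (Ne.symm hj) _)
    left
    simp only [ht]
    omega

end Hang

/-! ## Gram positivity on the odd torus: site hyperplane -/

section Site

variable {d L N : ℕ} [NeZero d] [NeZero L] [Fact (1 < L)]
variable {G : Type*} [Group G] [TopologicalSpace G] [IsTopologicalGroup G] [CompactSpace G]
  [MeasurableSpace G] [BorelSpace G]
variable (ρ : G →* Matrix (Fin N) (Fin N) ℂ)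

omit [NeZero L] [Fact (1 < L)] in
/-- The hanging staple is entry-measurable. [folklore] -/
theorem entryMeasurable_hangStaple (hρ : Continuous ρ) (j : Fin d) (R a : ℕ) :
    EntryMeasurable (CompactGroup.unitarize ρ hρ)
      fun U : GaugeConfig d L G => hangStaple j R a U := by
  have hσ := CompactGroup.continuous_unitarize ρ hρ
  unfold hangStaple
  exact ((EntryMeasurable.inv_unitarize ρ hρ (entryMeasurable_lineHolonomy hσ _ _ _)).mul
    (entryMeasurable_lineHolonomy hσ _ _ _)).mul (entryMeasurable_lineHolonomy hσ _ _ _)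

/-- **Gram positivity for rectangles bisected by the site hyperplane of the odd torus**
(complex form; its REAL part): for `L` odd, `L ≥ 3`, `β ≥ 0`, heights `a ≤ L/2` and real
coefficients, `0 ≤ Re ⟨∑_{a,b} c_a c_b tr σ(W_{(a+b) × R} based at (τ - a, 0⃗))⟩_{Λ,β}`. [folklore] -/
theorem re_wilsonExpectation_gram_hang_nonneg (hL : Odd L) (hL3 : 3 ≤ L) (hρ : Continuous ρ)
    {β : ℝ} (hβ : 0 ≤ β) {j : Fin d} (hj : j ≠ 0) (R : ℕ) (S : Finset ℕ)
    (hS : ∀ a ∈ S, a ≤ L / 2) (c : ℕ → ℝ) :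
    0 ≤ (wilsonExpectation ρ β fun U : GaugeConfig d L G => ∑ a ∈ S, ∑ b ∈ S, (c a * c b : ℂ) *
      (CompactGroup.unitarize ρ hρ (rectangleHolonomy U (hangBase a) 0 j (a + b) R)).trace).re := by
  set σ := CompactGroup.unitarize ρ hρ with hσdef
  haveI := isProbabilityMeasure_wilsonMeasure (d := d) (L := L) ρ hρ β
  set F : Fin N × Fin N → GaugeConfig d L G → ℂ :=
    fun il V => ∑ a ∈ S, (c a : ℂ) * conj (σ (hangStaple j R a V) il.1 il.2) with hFdef
  have hFm : ∀ il, Measurable (F il) := fun il =>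
    Finset.measurable_sum _ fun a _ =>
      (Complex.continuous_conj.measurable.comp (entryMeasurable_hangStaple ρ hρ j R a il.1 il.2)).const_mul _
  have hFb : ∀ il V, ‖F il V‖ ≤ ∑ a ∈ S, ‖(c a : ℂ)‖ := fun il V => by
    refine (norm_sum_le _ _).trans (Finset.sum_le_sum fun a _ => ?_)
    rw [norm_mul, Complex.norm_conj]
    exact mul_le_of_le_one_right (norm_nonneg _)
      (CompactGroup.norm_unitarize_apply_le_one ρ hρ _ _ _)
  have hFdep : ∀ il, DependsOn (F il)
      ((oPosEdges ∪ oSharedEdges : Finset (Edge d L)) : Set (Edge d L)) := by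
    intro il U V hUV
    refine Finset.sum_congr rfl fun a ha => ?_
    have h : ∀ e, IsOPosEdge e ∨ IsOSharedEdge e → U e = V e := fun e he => hUV e (by
      rcases he with he | he <;> simp [he])
    simp only [hangStaple_congr j R a fun e he =>
      h e (isOPosEdge_or_isOSharedEdge_of_isHangStapleEdge hL hj (hS a ha) he)]
  have hpos : ∀ il, 0 ≤ wilsonExpectation ρ β fun U => conj (F il U.timeReflect) * F il U := fun il =>
    wilsonExpectation_oddReflectionPositive ρ hL hL3 hρ hβ (F il) (hFm il) ⟨_, hFb il⟩ (hFdep il)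
  -- the pointwise identity `∑_{il} conj F_{il}(ΘU) F_{il}(U) = Φ(U)`
  have hpt : ∀ U : GaugeConfig d L G, (∑ il : Fin N × Fin N, conj (F il U.timeReflect) * F il U) =
      ∑ a ∈ S, ∑ b ∈ S, (c a * c b : ℂ) *
        (σ (rectangleHolonomy U (hangBase a) 0 j (a + b) R)).trace := by
    intro U
    have hR : ∀ a b, (σ (rectangleHolonomy U (hangBase a) 0 j (a + b) R)).trace =
        ∑ i, ∑ l, σ (hangStaple j R b U.timeReflect) i l * conj (σ (hangStaple j R a U) i l) := by
      intro a b
      rw [rectangleHolonomy_eq_hang U j, CompactGroup.trace_conj_eq, ← hangStaple_timeReflect hL U hj,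
        trace_unitarize_mul_inv ρ hρ]
    simp_rw [hR]
    rw [Fintype.sum_prod_type]
    simp only [hFdef, map_sum, map_mul, Complex.conj_ofReal, Complex.conj_conj]
    have h2 : ∀ a b, (c a * c b : ℂ) * ∑ i, ∑ l, σ (hangStaple j R b U.timeReflect) i l *
        conj (σ (hangStaple j R a U) i l) =
        ∑ i, ∑ l, (c a * c b : ℂ) * (σ (hangStaple j R b U.timeReflect) i l *
          conj (σ (hangStaple j R a U) i l)) := by
      intro a b
      rw [Finset.mul_sum]
      refine Finset.sum_congr rfl fun i _ => ?_
      rw [Finset.mul_sum]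
    simp_rw [h2]
    rw [show (∑ i : Fin N, ∑ l : Fin N, (∑ b ∈ S, (c b : ℂ) * σ (hangStaple j R b U.timeReflect) i l) *
        ∑ a ∈ S, (c a : ℂ) * conj (σ (hangStaple j R a U) i l)) =
        ∑ i : Fin N, ∑ l : Fin N, (∑ a ∈ S, (c a : ℂ) * conj (σ (hangStaple j R a U) i l)) *
          ∑ b ∈ S, (c b : ℂ) * σ (hangStaple j R b U.timeReflect) i l from
      Finset.sum_congr rfl fun i _ => Finset.sum_congr rfl fun l _ => mul_comm _ _,
      sum_sum_mul_sum_sum]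
    refine Finset.sum_congr rfl fun a _ => Finset.sum_congr rfl fun b _ =>
      Finset.sum_congr rfl fun i _ => Finset.sum_congr rfl fun l _ => by ring
  -- linearity
  have hint : ∀ il, Integrable (fun U : GaugeConfig d L G => conj (F il U.timeReflect) * F il U)
      (wilsonMeasure ρ β) := fun il =>
    Integrable.of_bound
      ((Complex.continuous_conj.measurable.comp ((hFm il).comp measurable_timeReflect)).mul
        (hFm il)).aestronglyMeasurable ((∑ a ∈ S, ‖(c a : ℂ)‖) * ∑ a ∈ S, ‖(c a : ℂ)‖)
      (ae_of_all _ fun U => by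
        rw [norm_mul, Complex.norm_conj]
        exact mul_le_mul (hFb _ _) (hFb _ _) (norm_nonneg _)
          ((norm_nonneg _).trans (hFb il U)))
  have hsum : wilsonExpectation ρ β (fun U : GaugeConfig d L G => ∑ a ∈ S, ∑ b ∈ S,
      (c a * c b : ℂ) * (σ (rectangleHolonomy U (hangBase a) 0 j (a + b) R)).trace) =
      ∑ il : Fin N × Fin N, wilsonExpectation ρ β fun U => conj (F il U.timeReflect) * F il U := by
    unfold wilsonExpectation
    rw [← integral_finsetSum _ fun il _ => hint il]
    exact integral_congr_ae (ae_of_all _ fun U => (hpt U).symm)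
  rw [hsum]
  exact (Complex.nonneg_iff.1 (Finset.sum_nonneg fun il _ => hpos il)).1

end Site

/-! ## The real Wilson loop expectations -/

section Real

variable {d L N : ℕ} [NeZero d] [NeZero L] [Fact (1 < L)]
variable {G : Type*} [Group G] [TopologicalSpace G] [IsTopologicalGroup G] [CompactSpace G]
  [MeasurableSpace G] [BorelSpace G]
variable (ρ : G →* Matrix (Fin N) (Fin N) ℂ)

omit [Fact (1 < L)] in
/-- The real part of a Gram expectation of unitarised loop traces (general base points) is the
Gram sum of the real Wilson loop expectations at the origin. [folklore] -/
theorem re_wilsonExpectation_gram_base (hρ : Continuous ρ) (hN : N ≠ 0) (β : ℝ) (j : Fin d) (R : ℕ)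
    (x : ℕ → ℕ → Site d L) (h : ℕ → ℕ → ℕ) (S : Finset ℕ) (c : ℕ → ℝ) :
    (wilsonExpectation ρ β fun U : GaugeConfig d L G => ∑ a ∈ S, ∑ b ∈ S, (c a * c b : ℂ) *
      (CompactGroup.unitarize ρ hρ (rectangleHolonomy U (x a b) 0 j (h a b) R)).trace).re =
      N * ∑ a ∈ S, ∑ b ∈ S, c a * c b *
        wilsonExpectation ρ β (wilsonLoop ρ (0 : Site d L) 0 j (h a b) R) := by
  set σ := CompactGroup.unitarize ρ hρ with hσdef
  haveI := isProbabilityMeasure_wilsonMeasure (d := d) (L := L) ρ hρ β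
  have htm : ∀ a b, Measurable fun U : GaugeConfig d L G =>
      (σ (rectangleHolonomy U (x a b) 0 j (h a b) R)).trace := fun a b =>
    (entryMeasurable_rectangleHolonomy ρ hρ _ _ _ _ _).measurable_trace
  have htb : ∀ a b (U : GaugeConfig d L G),
      ‖(σ (rectangleHolonomy U (x a b) 0 j (h a b) R)).trace‖ ≤ N := fun a b U => by
    rw [Matrix.trace]
    refine (norm_sum_le _ _).trans ?_
    calc ∑ k, ‖Matrix.diag (σ (rectangleHolonomy U (x a b) 0 j (h a b) R)) k‖
        ≤ ∑ _k : Fin N, (1 : ℝ) := Finset.sum_le_sum fun k _ =>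
          CompactGroup.norm_unitarize_apply_le_one ρ hρ _ k k
      _ = N := by simp
  have hint : ∀ a b, Integrable (fun U : GaugeConfig d L G =>
      (c a * c b : ℂ) * (σ (rectangleHolonomy U (x a b) 0 j (h a b) R)).trace)
      (wilsonMeasure ρ β) := fun a b =>
    (Integrable.of_bound (μ := wilsonMeasure ρ β) (htm a b).aestronglyMeasurable _
      (ae_of_all _ (htb a b))).const_mul _
  unfold wilsonExpectation
  rw [integral_finsetSum _ fun a _ => integrable_finsetSum _ fun b _ => hint a b, Complex.re_sum,
    Finset.mul_sum]
  refine Finset.sum_congr rfl fun a _ => ?_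
  rw [integral_finsetSum _ fun b _ => hint a b, Complex.re_sum, Finset.mul_sum]
  refine Finset.sum_congr rfl fun b _ => ?_
  have hre : (∫ U : GaugeConfig d L G,
      (σ (rectangleHolonomy U (x a b) 0 j (h a b) R)).trace ∂wilsonMeasure ρ β).re =
      ∫ U : GaugeConfig d L G,
        ((σ (rectangleHolonomy U (x a b) 0 j (h a b) R)).trace).re ∂wilsonMeasure ρ β := by
    have := integral_re (Integrable.of_bound (μ := wilsonMeasure ρ β) (htm a b).aestronglyMeasurable _
      (ae_of_all _ (htb a b)))
    simpa only [RCLike.re_to_complex] using this.symm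
  have hI : ∫ U : GaugeConfig d L G,
      ((σ (rectangleHolonomy U (x a b) 0 j (h a b) R)).trace).re ∂wilsonMeasure ρ β =
      N * ∫ U : GaugeConfig d L G, wilsonLoop ρ (x a b) 0 j (h a b) R U ∂wilsonMeasure ρ β := by
    rw [← integral_const_mul]
    refine integral_congr_ae (ae_of_all _ fun U => ?_)
    simp only [hσdef, CompactGroup.trace_unitarize, re_trace_eq_mul_wilsonLoop ρ hN]
  have hW := wilsonExpectation_wilsonLoop_base ρ β (x a b) 0 j (h a b) R
  unfold wilsonExpectation at hW
  rw [integral_const_mul, ← Complex.ofReal_mul, Complex.re_ofReal_mul, hre, hI, ← hW]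
  ring

/-- **Gram inequality for Wilson loops of odd height on the odd torus**: for `L` odd, `L ≥ 3`,
`β ≥ 0`, continuous `ρ`, `j ≠ 0`, heights `a + 1 ≤ L/2` and real coefficients,
`0 ≤ ∑_{a,b ∈ S} c_a c_b ⟨W_{(a+b+1) × R}⟩_{Λ_L,β}`. [folklore] -/
theorem gram_wilsonLoop_nonneg_link (hL : Odd L) (hL3 : 3 ≤ L) (hρ : Continuous ρ) {β : ℝ} (hβ : 0 ≤ β)
    {j : Fin d} (hj : j ≠ 0) (R : ℕ) (S : Finset ℕ) (hS : ∀ a ∈ S, a + 1 ≤ L / 2) (c : ℕ → ℝ) :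
    0 ≤ ∑ a ∈ S, ∑ b ∈ S, c a * c b *
      wilsonExpectation ρ β (wilsonLoop ρ (0 : Site d L) 0 j (a + b + 1) R) := by
  rcases Nat.eq_zero_or_pos N with hN | hN
  · subst hN
    simp [wilsonLoop, wilsonExpectation]
  have h := (Complex.nonneg_iff.1 (wilsonExpectation_gram_link_nonneg ρ hL hL3 hρ hβ hj R S hS c)).1
  rw [re_wilsonExpectation_gram_base ρ hρ hN.ne' β j R (fun _ b => tBase b) (fun a b => a + b + 1) S c]
    at h
  exact nonneg_of_mul_nonneg_right h (Nat.cast_pos.2 hN)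

/-- **Gram inequality for Wilson loops of even height on the odd torus**: for `L` odd,
`L ≥ 3`, `β ≥ 0`, continuous `ρ`, `j ≠ 0`, heights `a ≤ L/2` and real coefficients,
`0 ≤ ∑_{a,b ∈ S} c_a c_b ⟨W_{(a+b) × R}⟩_{Λ_L,β}`. [folklore] -/
theorem gram_wilsonLoop_nonneg_site (hL : Odd L) (hL3 : 3 ≤ L) (hρ : Continuous ρ) {β : ℝ} (hβ : 0 ≤ β)
    {j : Fin d} (hj : j ≠ 0) (R : ℕ) (S : Finset ℕ) (hS : ∀ a ∈ S, a ≤ L / 2) (c : ℕ → ℝ) :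
    0 ≤ ∑ a ∈ S, ∑ b ∈ S, c a * c b *
      wilsonExpectation ρ β (wilsonLoop ρ (0 : Site d L) 0 j (a + b) R) := by
  rcases Nat.eq_zero_or_pos N with hN | hN
  · subst hN
    simp [wilsonLoop, wilsonExpectation]
  have h := re_wilsonExpectation_gram_hang_nonneg ρ hL hL3 hρ hβ hj R S hS c
  rw [re_wilsonExpectation_gram_base ρ hρ hN.ne' β j R (fun a _ => hangBase a) (fun a b => a + b) S c]
    at h
  exact nonneg_of_mul_nonneg_right h (Nat.cast_pos.2 hN)

end Real

end WilsonLoopOddRP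

/-! ## The torus theorems without the `Fact (1 < L)` instance -/

section Main

variable {d L N : ℕ} {G : Type*} [Group G] [TopologicalSpace G] [IsTopologicalGroup G]
  [CompactSpace G] [MeasurableSpace G] [BorelSpace G] (ρ : G →* Matrix (Fin N) (Fin N) ℂ)

/-- **Gram inequality for Wilson loops of odd height on the odd torus** (reflection positivity
in the hyperplane between time slices of the odd torus; Seiler LNP 159 §2). For `L` odd,
`L ≥ 3`, `β ≥ 0`, continuous `ρ`, a spatial direction `j ≠ 0`, heights `a + 1 ≤ L/2` and real
coefficients: `0 ≤ ∑_{a,b ∈ S} c_a c_b ⟨W_{(a+b+1) × R}⟩_{Λ_L,β}`. [folklore] -/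
theorem gram_wilsonLoop_nonneg_odd_of_odd [NeZero d] [NeZero L] (hL : Odd L) (hL3 : 3 ≤ L)
    (hρ : Continuous ρ) {β : ℝ} (hβ : 0 ≤ β) {j : Fin d} (hj : j ≠ 0) (R : ℕ) (S : Finset ℕ)
    (hS : ∀ a ∈ S, a + 1 ≤ L / 2) (c : ℕ → ℝ) :
    0 ≤ ∑ a ∈ S, ∑ b ∈ S, c a * c b *
      wilsonExpectation ρ β (wilsonLoop ρ (0 : Site d L) 0 j (a + b + 1) R) := by
  haveI : Fact (1 < L) := ⟨by omega⟩
  exact WilsonLoopOddRP.gram_wilsonLoop_nonneg_link ρ hL hL3 hρ hβ hj R S hS c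

/-- **Gram inequality for Wilson loops of even height on the odd torus** (reflection positivity
in the site hyperplane `t = (L+1)/2` of the odd torus). For `L` odd, `L ≥ 3`, `β ≥ 0`,
continuous `ρ`, `j ≠ 0`, heights `a ≤ L/2` and real coefficients:
`0 ≤ ∑_{a,b ∈ S} c_a c_b ⟨W_{(a+b) × R}⟩_{Λ_L,β}`. [folklore] -/
theorem gram_wilsonLoop_nonneg_even_of_odd [NeZero d] [NeZero L] (hL : Odd L) (hL3 : 3 ≤ L)
    (hρ : Continuous ρ) {β : ℝ} (hβ : 0 ≤ β) {j : Fin d} (hj : j ≠ 0) (R : ℕ) (S : Finset ℕ)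
    (hS : ∀ a ∈ S, a ≤ L / 2) (c : ℕ → ℝ) :
    0 ≤ ∑ a ∈ S, ∑ b ∈ S, c a * c b *
      wilsonExpectation ρ β (wilsonLoop ρ (0 : Site d L) 0 j (a + b) R) := by
  haveI : Fact (1 < L) := ⟨by omega⟩
  exact WilsonLoopOddRP.gram_wilsonLoop_nonneg_site ρ hL hL3 hρ hβ hj R S hS c

end Main

end

end Literature.MathematicalPhysics.QuantumFieldTheory
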